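import Summits.CriticalPhenomena.CardyFormulaZ2.Theorems.CardyIKTransportIKLinearTransportWallDominationDefs

/-!
# `CardyIKTransport.IKLinearTransport` (stmt-CriticalPhenomena-5076, line `pinned-diagram-exchange`, lead c8 wave 1) —
# stub `stub_h1Gen : H1Gen`: BLACK CONNECTIVITY BETWEEN OLD CELLS OF THE WIDER SLAB = `PhiUV` AT THE CROSSING VECTOR

Support file (`--supports stmt-CriticalPhenomena-5076`), proving the registered sub-goal `stub_h1Gen : H1Gen` of
`…WallDominationDefs` §2: for an interior configuration `y` of the slab of `w` face columns whose last cell column is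
presented by the necklace `N`, a new column `(c, f)`, and two OLD cells `u, v`, the cells `(u.1.castSucc, u.2)` and
`(v.1.castSucc, v.2)` are joined by a black path of the wider slab `(splitEquiv w L).symm (y, (c, f))` iff
`PhiUV N y u v (N.crossVec c f)`: joined inside `y`, or `u` is joined inside `y` to some run, `v` to some run, and
the two runs are chained by `N.Linked y (N.crossVec c f)`.

This is the path surgery of the sister line's `stub_linkArcsIff` (`…TransportStubLinkArcsIff`, crux
`IKMixedBoxCrossing`) with the first arc replaced by the old cell `u` and the second arc by `v`:
* "⇐" (`blackConn_of_phiUV`): interior paths lift (`LinkArcsIffStub.blackConn_lift`) and a chain of links is a black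
  path of the wider slab between any two cells of its end runs (`LinkArcsIffStub.chain_conn`);
* "⇒" (`phiUV_of_blackConn`): induction along the black path read as a chain of black edges
  (`LinkArcsIffStub.rtg_of_blackConn`), carrying the invariant of `…TransportStubLinkArcsIff` with the old-cell
  clause "joined inside `y` to the first arc" replaced by "joined inside `y` to `u`" (`goodI_step`, `mem_of_goodI`,
  `good_step`, `good_of_rtg`); the new-column clause and its three step lemmas `goodN_of_entry`, `goodN_step`,
  `mem_of_exit` are the sister line's, verbatim.
-/

noncomputable section

namespace Summit.CriticalPhenomena.CardyFormulaZ2.Theorems.IKLinearTransport.PinnedDiagramExchange.WallDomination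

open scoped BigOperators Classical
open Finset
open Summit.CriticalPhenomena.CardyFormulaZ2.Cruxes.IKMixedBoxCrossing.DefectClosureExploration
open CylBunchStub (resLE resLast splitEquiv colConst)
open LinkArcsIffStub (ext_fst_castSucc ext_fst_last blackConn_lift adj_castSucc_iff adj_castSucc_last_iff
  adj_last_last_iff blackConn_refl blackConn_symm blackConn_trans blackConn_step rtg_of_blackConn chain_conn
  goodN_of_entry goodN_step mem_of_exit exists_inRun_of_col mk_mem_runCells)

namespace H1GenStub

variable {L : ℕ} {N : Necklace L} {w : ℕ} {y : CylCfg w L} {c f : ZMod L → Bool} {u : Fin (w + 1) × ZMod L}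
  {C : Fin N.k → Prop}

/-! ## Old cells: joined inside `y` to `u` or to a run of `C` -/

/-- OLD → OLD: a black edge of `y` preserves the invariant of old cells. -/
theorem goodI_step {i i' : Fin (w + 1)} {r r' : ZMod L}
    (hg : BlackConn y u (i, r) ∨ ∃ j, C j ∧ ∃ v ∈ N.runCells j, BlackConn y v (i, r))
    (hb : y.1 (i', r') = true) (ha : (cylGraph w L y.2).Adj (i, r) (i', r')) :
    BlackConn y u (i', r') ∨ ∃ j, C j ∧ ∃ v ∈ N.runCells j, BlackConn y v (i', r') := by
  rcases hg with hB | ⟨j, hj, v, hv, hB⟩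
  · exact Or.inl (blackConn_step hB hb ha)
  · exact Or.inr ⟨j, hj, v, hv, blackConn_step hB hb ha⟩

/-- A run whose cell satisfies the invariant of old cells is in `C`. -/
theorem mem_of_goodI (hC₁ : ∀ j, (∃ a ∈ N.runCells j, BlackConn y u a) → C j)
    (hC₂ : ∀ {j j' : Fin N.k}, C j → N.Linked y (N.crossVec c f) j j' → C j') {r : ZMod L}
    (hg : BlackConn y u (Fin.last w, r) ∨ ∃ j, C j ∧ ∃ v ∈ N.runCells j, BlackConn y v (Fin.last w, r))
    {j : Fin N.k} {o : ℕ} (ho : N.InRun j o) (hr : N.row o = r) : C j := by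
  have hmem : ((Fin.last w, r) : Fin (w + 1) × ZMod L) ∈ N.runCells j := hr ▸ mk_mem_runCells N ho
  rcases hg with hB | ⟨j', hj', v, hv, hB⟩
  · exact hC₁ j ⟨_, hmem, hB⟩
  · exact hC₂ hj' (Or.inr (Or.inr ⟨v, hv, _, hmem, hB⟩))

/-! ## The induction along the black path -/

/-- ONE BLACK EDGE of the wider slab preserves the invariant (old cells: joined inside `y` to `u` or to a run of `C`;
new cells: the sister line's partial-crossing clause). -/
theorem good_step (hcol : N.col = fun r => y.1 (Fin.last w, r))
    (hC₁ : ∀ j, (∃ a ∈ N.runCells j, BlackConn y u a) → C j)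
    (hC₂ : ∀ {j j' : Fin N.k}, C j → N.Linked y (N.crossVec c f) j j' → C j') {a b : Fin (w + 1 + 1) × ZMod L}
    (hg : (∀ i : Fin (w + 1), a.1 = i.castSucc →
        BlackConn y u (i, a.2) ∨ ∃ j, C j ∧ ∃ v ∈ N.runCells j, BlackConn y v (i, a.2)) ∧
      (a.1 = Fin.last (w + 1) → ∃ o, o < L ∧ N.row o = a.2 ∧ ((∃ i, N.InRun i o ∧ C i) ∨
        (∃ i, N.InGap i o ∧ C i ∧ (∀ t, N.gapStart i ≤ t → t ≤ o → c (N.row t) = true) ∧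
          (c (N.row (N.gapStart i - 1)) = true ∨ f (N.row (N.gapStart i - 1)) = false)) ∨
        (∃ i, N.InGap i o ∧ (∃ j : Fin N.k, j.val = (i.val + 1) % N.k ∧ C j) ∧
          (∀ t, o ≤ t → t < N.gapStart i + N.gapLen i → c (N.row t) = true) ∧
          (c (N.row (N.gapStart i + N.gapLen i)) = true ∨ f (N.row (N.gapStart i + N.gapLen i - 1)) = true)))))
    (hab : ((splitEquiv w L).symm (y, (c, f))).1 a = true ∧ ((splitEquiv w L).symm (y, (c, f))).1 b = true ∧
      (cylGraph (w + 1) L ((splitEquiv w L).symm (y, (c, f))).2).Adj a b) :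
    (∀ i : Fin (w + 1), b.1 = i.castSucc →
        BlackConn y u (i, b.2) ∨ ∃ j, C j ∧ ∃ v ∈ N.runCells j, BlackConn y v (i, b.2)) ∧
      (b.1 = Fin.last (w + 1) → ∃ o, o < L ∧ N.row o = b.2 ∧ ((∃ i, N.InRun i o ∧ C i) ∨
        (∃ i, N.InGap i o ∧ C i ∧ (∀ t, N.gapStart i ≤ t → t ≤ o → c (N.row t) = true) ∧
          (c (N.row (N.gapStart i - 1)) = true ∨ f (N.row (N.gapStart i - 1)) = false)) ∨
        (∃ i, N.InGap i o ∧ (∃ j : Fin N.k, j.val = (i.val + 1) % N.k ∧ C j) ∧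
          (∀ t, o ≤ t → t < N.gapStart i + N.gapLen i → c (N.row t) = true) ∧
          (c (N.row (N.gapStart i + N.gapLen i)) = true ∨ f (N.row (N.gapStart i + N.gapLen i - 1)) = true)))) := by
  obtain ⟨a1, ar⟩ := a
  obtain ⟨b1, br⟩ := b
  obtain ⟨ha, hb, hadj⟩ := hab
  rcases Fin.eq_castSucc_or_eq_last a1 with ⟨i, rfl⟩ | rfl <;>
    rcases Fin.eq_castSucc_or_eq_last b1 with ⟨i', rfl⟩ | rfl
  · -- old → old: an edge of `y`
    rw [ext_fst_castSucc] at hb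
    have hadj' := (adj_castSucc_iff (y := y) (c := c) (f := f) (i, ar) (i', br)).1 hadj
    refine ⟨fun i'' h => ?_, fun h => absurd h (Fin.castSucc_ne_last _)⟩
    rw [← Fin.castSucc_inj.1 h]
    exact goodI_step (hg.1 i rfl) hb hadj'
  · -- old → new: entering the new column from a run cell
    obtain ⟨rfl, he⟩ := (adj_castSucc_last_iff i ar br).1 hadj
    rw [ext_fst_castSucc] at ha
    rw [ext_fst_last] at hb
    obtain ⟨j, o, -, ho, hro⟩ := exists_inRun_of_col N (show N.col ar = true by rw [hcol]; exact ha)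
    have hC := mem_of_goodI hC₁ hC₂ (hg.1 _ rfl) ho hro
    exact ⟨fun i'' h => absurd h.symm (Fin.castSucc_ne_last _), fun _ => goodN_of_entry hC ho hro hb he⟩
  · -- new → old: leaving the new column onto a run cell
    obtain ⟨rfl, he⟩ := (adj_castSucc_last_iff i' br ar).1 hadj.symm
    rw [ext_fst_last] at ha
    rw [ext_fst_castSucc] at hb
    obtain ⟨i₁, o₁, -, ho₁, hro₁⟩ := exists_inRun_of_col N (show N.col br = true by rw [hcol]; exact hb)
    have hC : C i₁ := by
      refine mem_of_exit hC₂ (hg.2 rfl) ho₁ ?_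
      rw [hro₁]
      rcases he with h | ⟨h1, h2⟩ | ⟨h1, h2⟩
      exacts [Or.inl h.symm, Or.inr (Or.inr ⟨h1, h2⟩), Or.inr (Or.inl ⟨h1, h2⟩)]
    refine ⟨fun i'' h => ?_, fun h => absurd h (Fin.castSucc_ne_last _)⟩
    rw [← Fin.castSucc_inj.1 h]
    exact Or.inr ⟨i₁, hC, _, hro₁ ▸ mk_mem_runCells N ho₁, blackConn_refl hb⟩
  · -- new → new: a vertical step in the new column
    obtain ⟨-, he⟩ := (adj_last_last_iff ar br).1 hadj
    rw [ext_fst_last] at ha hb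
    exact ⟨fun i'' h => absurd h.symm (Fin.castSucc_ne_last _), fun _ => goodN_step hC₂ (hg.2 rfl) ha hb he⟩

/-- THE INVARIANT along a black path of the wider slab starting at the old cell `u`. -/
theorem good_of_rtg (hcol : N.col = fun r => y.1 (Fin.last w, r))
    (hC₁ : ∀ j, (∃ a ∈ N.runCells j, BlackConn y u a) → C j)
    (hC₂ : ∀ {j j' : Fin N.k}, C j → N.Linked y (N.crossVec c f) j j' → C j') (hu : y.1 u = true)
    {v : Fin (w + 1 + 1) × ZMod L}
    (h : Relation.ReflTransGen (fun a b => ((splitEquiv w L).symm (y, (c, f))).1 a = true ∧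
        ((splitEquiv w L).symm (y, (c, f))).1 b = true ∧
        (cylGraph (w + 1) L ((splitEquiv w L).symm (y, (c, f))).2).Adj a b) (u.1.castSucc, u.2) v) :
    (∀ i : Fin (w + 1), v.1 = i.castSucc →
        BlackConn y u (i, v.2) ∨ ∃ j, C j ∧ ∃ v' ∈ N.runCells j, BlackConn y v' (i, v.2)) ∧
      (v.1 = Fin.last (w + 1) → ∃ o, o < L ∧ N.row o = v.2 ∧ ((∃ i, N.InRun i o ∧ C i) ∨
        (∃ i, N.InGap i o ∧ C i ∧ (∀ t, N.gapStart i ≤ t → t ≤ o → c (N.row t) = true) ∧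
          (c (N.row (N.gapStart i - 1)) = true ∨ f (N.row (N.gapStart i - 1)) = false)) ∨
        (∃ i, N.InGap i o ∧ (∃ j : Fin N.k, j.val = (i.val + 1) % N.k ∧ C j) ∧
          (∀ t, o ≤ t → t < N.gapStart i + N.gapLen i → c (N.row t) = true) ∧
          (c (N.row (N.gapStart i + N.gapLen i)) = true ∨ f (N.row (N.gapStart i + N.gapLen i - 1)) = true)))) := by
  induction h with
  | refl =>
    refine ⟨fun i hi => ?_, fun h => absurd h (Fin.castSucc_ne_last _)⟩
    obtain rfl : u.1 = i := Fin.castSucc_inj.1 hi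
    exact Or.inl (blackConn_refl hu)
  | tail _ hbc ih => exact good_step hcol hC₁ hC₂ ih hbc

/-- "⇒": a black path of the wider slab between two old cells forces `PhiUV` at the crossing vector (the invariant
with `C` = the runs chained to a run joined to `u` inside `y`, read at the endpoint). -/
theorem phiUV_of_blackConn (hcol : N.col = fun r => y.1 (Fin.last w, r)) {v : Fin (w + 1) × ZMod L}
    (hB : BlackConn ((splitEquiv w L).symm (y, (c, f))) (u.1.castSucc, u.2) (v.1.castSucc, v.2)) :
    PhiUV N y u v (N.crossVec c f) := by
  have hu : y.1 u = true := by
    have h1 := hB.1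
    rwa [ext_fst_castSucc] at h1
  have hg := good_of_rtg
    (C := fun j => ∃ i, (∃ a ∈ N.runCells i, BlackConn y u a) ∧
      Relation.ReflTransGen (N.Linked y (N.crossVec c f)) i j)
    hcol (fun j hj => ⟨j, hj, Relation.ReflTransGen.refl⟩) (fun ⟨i, hi, hij⟩ hl => ⟨i, hi, hij.tail hl⟩)
    hu (rtg_of_blackConn hB)
  rcases hg.1 v.1 rfl with hB' | ⟨j, ⟨i, hi, hij⟩, b, hb, hB'⟩
  · exact Or.inl hB'
  · exact Or.inr ⟨i, j, hi, ⟨b, hb, blackConn_symm hB'⟩, hij⟩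

/-! ## "⇐": the link function forces the black path -/

/-- "⇐": `PhiUV` at the crossing vector forces a black path of the wider slab between the two old cells. -/
theorem blackConn_of_phiUV (N : Necklace L) (hcol : N.col = fun r => y.1 (Fin.last w, r))
    {u v : Fin (w + 1) × ZMod L} (h : PhiUV N y u v (N.crossVec c f)) :
    BlackConn ((splitEquiv w L).symm (y, (c, f))) (u.1.castSucc, u.2) (v.1.castSucc, v.2) := by
  rcases h with hB | ⟨i, j, ⟨a, ha, hB1⟩, ⟨b, hb, hB2⟩, hij⟩
  · exact blackConn_lift hB
  · obtain ⟨ha1, p, -, hpa, hpr⟩ := ha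
    obtain ⟨hb1, q, -, hqb, hqr⟩ := hb
    have hl1 := blackConn_lift (c := c) (f := f) hB1
    have hl2 := blackConn_lift (c := c) (f := f) hB2
    obtain ⟨a1, a2⟩ := a
    obtain ⟨b1, b2⟩ := b
    simp only at ha1 hb1 hpr hqr hl1 hl2
    subst ha1 hb1 hpr hqr
    exact blackConn_trans (blackConn_trans hl1 (chain_conn N hcol hij hpa hqb)) (blackConn_symm hl2)

end H1GenStub

/-- **Registered sub-goal `stub_h1Gen` (H1 general: path surgery, line `pinned-diagram-exchange`, lead c8)**: black
connectivity between the old cells `(u.1.castSucc, u.2)`, `(v.1.castSucc, v.2)` of the slab of `w + 1` face columns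
at `(splitEquiv w L).symm (y, (c, f))` is the value of the general necklace link function `PhiUV N y u v` at the
gap-crossing vector `N.crossVec c f` of the new column. -/
theorem stub_h1Gen : H1Gen := fun _ _ _ _ N hcol _ _ _ _ =>
  ⟨fun h => H1GenStub.phiUV_of_blackConn hcol h, fun h => H1GenStub.blackConn_of_phiUV N hcol h⟩

end Summit.CriticalPhenomena.CardyFormulaZ2.Theorems.IKLinearTransport.PinnedDiagramExchange.WallDomination

end
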